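import Mathlib.Logic.Relation
import HarnessLib

/-!
# Venture HSemireg — LAYER BLOCKS: the Weil part of a layer is a union of rectangles over a link relation between blocks; a Weil–Weil crossing needs an induced 2K₂

Companion to `FibrePartition.lean` (THEOREM F, k = 161), `AdditiveNetClassDeath.lean` (THEOREM H-NET) and
`NetPropagation.lean` — cell pub-hsemireg, seat p2 (gen 14 statement, gen 15 kernel form), note
`p2/wlaws/NET-REDUCTION-p2g14.md` §2c «THEOREM (LAYER BLOCKS)» (a)–(c) and §2e (RECTANGLE VERSION).

SETTING (there). Fix a sloped slot-3 line `m` of a reduced flat-LEGO configuration `Z`.  The WEIL PART of the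
`m`-layer is the set `W(m)` of pairs of sloped lines `(ℓ, L)` (slots 1, 2) with `(ℓ, L, m) ∈ Z`.  For a point `r`
of `m`, the (sloped) B-system at `r` is `{L : (S, L, r) ∈ Z}` and the (sloped) P-system at `r` is
`{ℓ : (ℓ, S, r) ∈ Z}`; `r` is a B-foot of `L` iff `L` lies in the B-system at `r`, a P-foot of `ℓ` likewise.  The
catalogue facts used (tier of `WEIL-PROLIFERATION-p2g8.md` §3, level-free) are the B-fan and the P-fan WITH UPGRADE
(«`(ℓ,L,m) ∈ Z`, `r ∈ m` a B-foot of `L`, `L′` in the B-system at `r` ⇒ `(ℓ,L′,m) ∈ Z`», and its slot-1 mirror), and,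
for part (c), ζ in both point slots («two triples over `m` sharing their slot-2 line exclude the A-pad at a crossing
of their slot-1 lines», and its mirror) — exactly the hypotheses `zeta₁`, `zeta₂` of `NetPropagation.lean`, here
needed for Weil pairs only.

THIS FILE is the kernel form of the note's THEOREM (LAYER BLOCKS), as abstract bookkeeping over slot-1 lines `L₁`,
slot-2 lines `L₂`, points `R` of `m`, points `P₁`, `P₂` of the two point slots, and the data of ONE layer:
`W ℓ L` = «(ℓ,L,m) ∈ Z, both sloped», `FP r ℓ` = «(ℓ,S,r) ∈ Z» (sloped P-system at `r`), `FB r L` = «(S,L,r) ∈ Z»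
(sloped B-system at `r`), `A p` = «(p,S,m) ∈ Z», `A' q` = «(S,q,m) ∈ Z», incidences `on₁`, `on₂`.  The LINK of two
slot-2 lines is «both lie in the B-system at some point of `m`» (`link FB`), the BLOCKS are the classes of the
equivalence relation it generates (`Relation.EqvGen` of that link); likewise in slot 1 with `FP`.
* `mem_block_of_foot` ((a), the trivial direction): a common foot links; blocks are unions of foot systems.
* `weil_iff_of_block₂` ∕ `weil_iff_of_block₁`: along a block the Weil pairs with a fixed partner do not change.
* `rectangle` ((b) RECTANGLES): `(ℓ,L) ∈ W(m)`, `ℓ′` in the block of `ℓ`, `L′` in the block of `L` ⇒ `(ℓ′,L′) ∈ W(m)`;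
  so `W(m)` is the blow-up of a bipartite LINK RELATION between blocks.
* `crossing` ((c) CROSSINGS, with ζ): two DIFFERENT Weil pairs `(ℓ,L)`, `(ℓ*,L*)` through a doubly-footed curve
  `p × q × m` (`p ∈ ℓ ∩ ℓ*`, `q ∈ L ∩ L*`, both pads) have `ℓ ≠ ℓ*`, `L ≠ L*`, lie in different blocks in BOTH slots,
  and neither cross pair of blocks is linked: an INDUCED 2K₂ of the link relation.
* `unique_weil_pair_of_no_induced_2K2` (the contrapositive used as «(β)»): if the link relation has no induced 2K₂
  (every two Weil pairs in different blocks in both slots have a linked cross pair), then through a doubly-footed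
  curve passes at most ONE Weil pair — in particular under (PW) (one rectangle), for a star, or for a complete
  bipartite link relation.
What the kernel certifies: the LOGIC of (a)–(c); what it does not: that a given support satisfies the fans, ζ, or has
a 2K₂-free link relation (note §2c (d), §3: censuses — 58 ∕ 58 Weil layers of the 17 skeletons of record are ONE
rectangle; the net-less W-free closures are two rectangles linked as a matching, with the crossings between them).

HONEST FRAMING. Finite incidence bookkeeping; no variety, cycle, cohomology class or semiregularity map occurs; nothing
here bears on HC ∕ HC_CM ∕ HC_AV.
-/

namespace Summit.Ventures.HSemireg
namespace LayerBlocks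

open Relation

variable {P₁ P₂ L₁ L₂ R : Type*}

/-- **(a)** The LINK of two lines of one slot: both lie in the (sloped) foot system `Fsys r` at some point `r` of
`m` (`Fsys = FB` for slot 2, `Fsys = FP` for slot 1); the BLOCKS are the classes of `Relation.EqvGen` of this link.
A common foot puts two lines in one block: every block is a union of full foot systems. -/
theorem mem_block_of_foot (Fsys : R → L₂ → Prop) {r : R} {L L' : L₂} (hL : Fsys r L) (hL' : Fsys r L') :
    EqvGen (fun y y' => ∃ r, Fsys r y ∧ Fsys r y') L L' :=
  EqvGen.rel L L' ⟨r, hL, hL'⟩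

/-- Along a slot-2 block the Weil pairs with a fixed slot-1 line do not change (B-fan with upgrade, iterated). -/
theorem weil_iff_of_block₂ (W : L₁ → L₂ → Prop) (FB : R → L₂ → Prop)
    (fanB : ∀ ℓ L L' r, W ℓ L → FB r L → FB r L' → W ℓ L')
    (ℓ : L₁) {L L' : L₂} (h : EqvGen (fun y y' => ∃ r, FB r y ∧ FB r y') L L') :
    W ℓ L ↔ W ℓ L' := by
  induction h with
  | rel y y' hyy' =>
      obtain ⟨r, hy, hy'⟩ := hyy'
      exact ⟨fun hW => fanB ℓ y y' r hW hy hy', fun hW => fanB ℓ y' y r hW hy' hy⟩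
  | refl y => exact Iff.rfl
  | symm y y' _ ih => exact ih.symm
  | trans y y' y'' _ _ ih₁ ih₂ => exact ih₁.trans ih₂

/-- Along a slot-1 block the Weil pairs with a fixed slot-2 line do not change (P-fan with upgrade, iterated). -/
theorem weil_iff_of_block₁ (W : L₁ → L₂ → Prop) (FP : R → L₁ → Prop)
    (fanP : ∀ ℓ ℓ' L r, W ℓ L → FP r ℓ → FP r ℓ' → W ℓ' L)
    (L : L₂) {ℓ ℓ' : L₁} (h : EqvGen (fun x x' => ∃ r, FP r x ∧ FP r x') ℓ ℓ') :
    W ℓ L ↔ W ℓ' L := by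
  induction h with
  | rel x x' hxx' =>
      obtain ⟨r, hx, hx'⟩ := hxx'
      exact ⟨fun hW => fanP x x' L r hW hx hx', fun hW => fanP x' x L r hW hx' hx⟩
  | refl x => exact Iff.rfl
  | symm x x' _ ih => exact ih.symm
  | trans x x' x'' _ _ ih₁ ih₂ => exact ih₁.trans ih₂

/-- **(b) RECTANGLES.**  `(ℓ, L) ∈ W(m)`, `ℓ′` in the block of `ℓ`, `L′` in the block of `L` ⇒ `(ℓ′, L′) ∈ W(m)`:
the Weil part of the layer is the union of the full rectangles `D × C` over the linked block pairs `(D, C)`. -/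
theorem rectangle (W : L₁ → L₂ → Prop) (FP : R → L₁ → Prop) (FB : R → L₂ → Prop)
    (fanP : ∀ ℓ ℓ' L r, W ℓ L → FP r ℓ → FP r ℓ' → W ℓ' L)
    (fanB : ∀ ℓ L L' r, W ℓ L → FB r L → FB r L' → W ℓ L')
    {ℓ ℓ' : L₁} {L L' : L₂} (hW : W ℓ L)
    (hD : EqvGen (fun x x' => ∃ r, FP r x ∧ FP r x') ℓ ℓ')
    (hC : EqvGen (fun y y' => ∃ r, FB r y ∧ FB r y') L L') : W ℓ' L' :=
  (weil_iff_of_block₁ W FP fanP L' hD).mp ((weil_iff_of_block₂ W FB fanB ℓ hC).mp hW)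

/-- **(c) CROSSINGS (with ζ).**  Two different Weil pairs `(ℓ, L)`, `(ℓ*, L*)` of the layer through ONE doubly-footed
curve `p × q × m` (`p ∈ ℓ ∩ ℓ*` carries the A-pad, `q ∈ L ∩ L*` the A′-pad) have `ℓ ≠ ℓ*` and `L ≠ L*`, lie in
different blocks in both slots, and NEITHER cross pair of blocks is linked (no Weil pair in `block(ℓ*) × block(L)`,
none in `block(ℓ) × block(L*)`): the two rectangles form an induced 2K₂ of the link relation. -/
theorem crossing (W : L₁ → L₂ → Prop) (FP : R → L₁ → Prop) (FB : R → L₂ → Prop)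
    (A : P₁ → Prop) (A' : P₂ → Prop) (on₁ : P₁ → L₁ → Prop) (on₂ : P₂ → L₂ → Prop)
    (fanP : ∀ ℓ ℓ' L r, W ℓ L → FP r ℓ → FP r ℓ' → W ℓ' L)
    (fanB : ∀ ℓ L L' r, W ℓ L → FB r L → FB r L' → W ℓ L')
    (zeta₁ : ∀ ℓ ℓ' L p, W ℓ L → W ℓ' L → ℓ ≠ ℓ' → on₁ p ℓ → on₁ p ℓ' → ¬ A p)
    (zeta₂ : ∀ ℓ L L' q, W ℓ L → W ℓ L' → L ≠ L' → on₂ q L → on₂ q L' → ¬ A' q)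
    {ℓ ℓs : L₁} {L Ls : L₂} {p : P₁} {q : P₂}
    (hW : W ℓ L) (hWs : W ℓs Ls) (hne : ℓ ≠ ℓs ∨ L ≠ Ls)
    (hpℓ : on₁ p ℓ) (hpℓs : on₁ p ℓs) (hqL : on₂ q L) (hqLs : on₂ q Ls) (hA : A p) (hA' : A' q) :
    ℓ ≠ ℓs ∧ L ≠ Ls ∧
    ¬ EqvGen (fun x x' => ∃ r, FP r x ∧ FP r x') ℓ ℓs ∧
    ¬ EqvGen (fun y y' => ∃ r, FB r y ∧ FB r y') L Ls ∧
    (∀ ℓ' L', EqvGen (fun x x' => ∃ r, FP r x ∧ FP r x') ℓs ℓ' →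
        EqvGen (fun y y' => ∃ r, FB r y ∧ FB r y') L L' → ¬ W ℓ' L') ∧
    (∀ ℓ' L', EqvGen (fun x x' => ∃ r, FP r x ∧ FP r x') ℓ ℓ' →
        EqvGen (fun y y' => ∃ r, FB r y ∧ FB r y') Ls L' → ¬ W ℓ' L') := by
  -- the two «mixed» pairs are excluded by ζ at the feet
  have hnot₁ : ¬ W ℓs L := by
    intro h
    rcases hne with hℓ | hL
    · exact zeta₁ ℓ ℓs L p hW h hℓ hpℓ hpℓs hA
    · -- ℓ = ℓs is then impossible too: (ℓs, L), (ℓs, Ls) share ℓs with L ≠ Ls through q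
      by_cases hℓ : ℓ = ℓs
      · subst hℓ
        exact zeta₂ ℓ L Ls q hW hWs hL hqL hqLs hA'
      · exact zeta₁ ℓ ℓs L p hW h hℓ hpℓ hpℓs hA
  have hnot₂ : ¬ W ℓ Ls := by
    intro h
    rcases hne with hℓ | hL
    · by_cases hL : L = Ls
      · subst hL
        exact zeta₁ ℓ ℓs L p hW hWs hℓ hpℓ hpℓs hA
      · exact zeta₂ ℓ L Ls q hW h hL hqL hqLs hA'
    · exact zeta₂ ℓ L Ls q hW h hL hqL hqLs hA'
  have hℓne : ℓ ≠ ℓs := by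
    rintro rfl
    exact hnot₁ hW
  have hLne : L ≠ Ls := by
    rintro rfl
    exact hnot₂ hW
  refine ⟨hℓne, hLne, ?_, ?_, ?_, ?_⟩
  · -- same slot-1 block ⇒ (ℓs, L) ∈ W by (b)
    intro hD
    exact hnot₁ (rectangle W FP FB fanP fanB hW hD (EqvGen.refl L))
  · intro hC
    exact hnot₂ (rectangle W FP FB fanP fanB hW (EqvGen.refl ℓ) hC)
  · -- linked (block ℓs, block L) ⇒ (ℓs, L) ∈ W by (b)
    intro ℓ' L' hD hC hW'
    exact hnot₁ (rectangle W FP FB fanP fanB hW' (EqvGen.symm _ _ hD) (EqvGen.symm _ _ hC))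
  · intro ℓ' L' hD hC hW'
    exact hnot₂ (rectangle W FP FB fanP fanB hW' (EqvGen.symm _ _ hD) (EqvGen.symm _ _ hC))

/-- **No induced 2K₂ ⇒ one Weil pair per doubly-footed curve** (the form in which (c) is used: (PW) = one rectangle,
a star, or a complete bipartite link relation are all 2K₂-free).  Hypothesis `no2K2`: any two Weil pairs lie in a
common slot-1 block, or in a common slot-2 block, or have a linked cross pair of blocks. -/
theorem unique_weil_pair_of_no_induced_2K2 (W : L₁ → L₂ → Prop) (FP : R → L₁ → Prop) (FB : R → L₂ → Prop)
    (A : P₁ → Prop) (A' : P₂ → Prop) (on₁ : P₁ → L₁ → Prop) (on₂ : P₂ → L₂ → Prop)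
    (fanP : ∀ ℓ ℓ' L r, W ℓ L → FP r ℓ → FP r ℓ' → W ℓ' L)
    (fanB : ∀ ℓ L L' r, W ℓ L → FB r L → FB r L' → W ℓ L')
    (zeta₁ : ∀ ℓ ℓ' L p, W ℓ L → W ℓ' L → ℓ ≠ ℓ' → on₁ p ℓ → on₁ p ℓ' → ¬ A p)
    (zeta₂ : ∀ ℓ L L' q, W ℓ L → W ℓ L' → L ≠ L' → on₂ q L → on₂ q L' → ¬ A' q)
    (no2K2 : ∀ ℓ L ℓs Ls, W ℓ L → W ℓs Ls →
      EqvGen (fun x x' => ∃ r, FP r x ∧ FP r x') ℓ ℓs ∨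
      EqvGen (fun y y' => ∃ r, FB r y ∧ FB r y') L Ls ∨
      (∃ ℓ' L', EqvGen (fun x x' => ∃ r, FP r x ∧ FP r x') ℓs ℓ' ∧
        EqvGen (fun y y' => ∃ r, FB r y ∧ FB r y') L L' ∧ W ℓ' L') ∨
      (∃ ℓ' L', EqvGen (fun x x' => ∃ r, FP r x ∧ FP r x') ℓ ℓ' ∧
        EqvGen (fun y y' => ∃ r, FB r y ∧ FB r y') Ls L' ∧ W ℓ' L'))
    {ℓ ℓs : L₁} {L Ls : L₂} {p : P₁} {q : P₂}
    (hW : W ℓ L) (hWs : W ℓs Ls)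
    (hpℓ : on₁ p ℓ) (hpℓs : on₁ p ℓs) (hqL : on₂ q L) (hqLs : on₂ q Ls) (hA : A p) (hA' : A' q) :
    ℓ = ℓs ∧ L = Ls := by
  refine Classical.byContradiction fun hcon => ?_
  have hne : ℓ ≠ ℓs ∨ L ≠ Ls := by
    by_cases hℓ : ℓ = ℓs
    · exact Or.inr fun hL => hcon ⟨hℓ, hL⟩
    · exact Or.inl hℓ
  obtain ⟨-, -, hD, hC, hX₁, hX₂⟩ :=
    crossing W FP FB A A' on₁ on₂ fanP fanB zeta₁ zeta₂ hW hWs hne hpℓ hpℓs hqL hqLs hA hA'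
  rcases no2K2 ℓ L ℓs Ls hW hWs with h | h | ⟨ℓ', L', hD', hC', hW'⟩ | ⟨ℓ', L', hD', hC', hW'⟩
  · exact hD h
  · exact hC h
  · exact hX₁ ℓ' L' hD' hC' hW'
  · exact hX₂ ℓ' L' hD' hC' hW'

end LayerBlocks
end Summit.Ventures.HSemireg
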